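import Summits.NavierStokesRegularity.FluidComputer.TubeStage

/-!
# The tube certificate as a cascade stage, part 2: the design hand-off chains the cone certificate
with itself; the spec window; and what that hand-off idealises (THE HAND-OFF AUDIT)

Companion file of `TubeStage.lean` (cell `pub-fluidc`, blueprint seat bp3, gen 14; the two files are ONE
text of bp3's, split only because files of the summit's topic directory obey the 400-line rule; every
declaration is verbatim, same namespace `Summit.NavierStokesRegularity.FluidComputer.TubeStage`).
HONEST FRAMING (verbatim): low prior, high value-of-information experiment on Tao's machine paradigm;
NOT a claim that NS blows up. Everything here concerns the 5-mode quadratic, energy-conserving TRUNCATION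
`thresholdCircuit` with an ABSTRACT forcing of sup-size `δ`; nothing is proved about the Navier–Stokes
equations, and the cascade-level statements are about the idealised design hand-off, whose
idealisations are listed in §4. Contents (bullets verbatim from the original single-file docstring):

* §3 `TubeStage.handOff_image_cone_subset`, `TubeStage.inputBoxCone_chains` — the design hand-off of
  [Tao2016AveragedNS, §6.1] (`handOff zL`: the output mode becomes the next carrier, re-read in units
  of the output floor `zL`, fresh modes empty) maps the output cone INTO the input cone of the same
  level, so the cone certificate chains with itself generation after generation with non-decreasing
  level; `eta_cert_ge`, `alphaEff_ge_two_of_eta` — the certified per-generation energy fraction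
  `EoutL/(1 + 3·10⁻⁵) ≥ 0.9223` lies in the blueprint's spec window (`α_eff ≥ 2 ⟺ η ≥ 1/2`).
* §4 `TubeStage.handOff_fresh_modes` + docstring — THE HAND-OFF AUDIT: what `handOff` erases, with
  the numbers of the coupled two-gate experiment (bp3 gen 14 `code/thgate/g14/chain.py`).

[cite: Tao2016AveragedNS, §5.5 Thm 5.3 (5.5); §6.1 (6.1), (6.4), Remark 6.1]
-/

noncomputable section

open Set Filter Topology
open scoped Pointwise

namespace Summit.NavierStokesRegularity.FluidComputer

open Literature.Analysis.FluidPDE.Tao2016AveragedNS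
open Literature.Analysis.FluidPDE.FluidComputer
open Literature.Analysis.FluidPDE.FluidComputer.TubeTable
open Literature.Analysis.FluidPDE.FluidComputer.ThresholdLevelTable (Gt Gt_valid Rbt)
open Literature.Analysis.FluidPDE.FluidComputer.ThresholdLevelTableL (T₃L EoutL)

namespace TubeStage

/-! ### §3. The design hand-off chains the cone certificate with itself; the spec window -/

/-- Tao's datum `(1,0,0,0,0)` lies in the input box. [folklore] -/
theorem delayInit_mem_inputBox : delayInit ∈ InputBox := by
  have h0 : delayInit 0 = 1 := rfl
  have h1 : delayInit 1 = 0 := rfl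
  have h2 : delayInit 2 = 0 := rfl
  have h3 : delayInit 3 = 0 := rfl
  have h4 : delayInit 4 = 0 := rfl
  refine mem_inputBox_of ?_ ?_ ⟨?_, ?_⟩ ?_ ?_ <;> simp only [h0, h1, h2, h3, h4] <;> norm_num

/-- **THE DESIGN HAND-OFF MAPS THE OUTPUT CONE INTO THE INPUT CONE OF THE SAME LEVEL.** Re-read in
units of the output floor `zL`, the hand-off `handOff zL z = (z 4 / zL) • delayInit` of
[Tao2016AveragedNS, §6.1] sends a loaded output `c • w`, `w 4 ≥ zL`, `c ≥ c₀`, to the next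
generation's input `(c · w 4 / zL) • delayInit` at level `c · w 4 / zL ≥ c ≥ c₀` (`c₀ ≥ 0`).
[cite: Tao2016AveragedNS, §6.1 (6.1), (6.4), Remark 6.1] -/
theorem handOff_image_cone_subset {c₀ : ℝ} (hc₀ : 0 ≤ c₀) :
    handOff zL '' coneFrom c₀ (outputAbove zL) ⊆ coneFrom c₀ InputBox := by
  rintro _ ⟨p, ⟨c, hc, w, hw, rfl⟩, rfl⟩
  have hwz : 1 ≤ w 4 / zL := by
    rw [le_div_iff₀ zL_pos, one_mul]
    exact hw
  refine ⟨c * (w 4 / zL), by nlinarith, delayInit, delayInit_mem_inputBox, ?_⟩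
  rw [handOff_smul, handOff, smul_smul]

/-- **THE CONE CERTIFICATE CHAINS WITH ITSELF** through the design hand-off: for every floor level
`c₀ ≥ 1` the hand-off image of its output region lies in its input region. In the idealised cascade
(§4) generation `n+1` is therefore served by the SAME certificate as generation `n`, at a level that
never decreases. [cite: Tao2016AveragedNS, §6.1 (6.1), (6.4), Remark 6.1] -/
theorem inputBoxCone_chains {c₀ : ℝ} (hc₀ : 1 ≤ c₀) :
    handOff zL '' coneFrom c₀ (outputAbove zL) ⊆ coneFrom c₀ InputBox ∧
      Nonempty (ReachCertificate (thresholdCircuit Gt.ε Gt.σ Gt.ν Gt.μ Gt.r Gt.κ) univ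
        (c₀ ^ 2 * Gt.δ) (Tcyc / c₀) (coneFrom c₀ InputBox) (coneFrom c₀ (outputAbove zL))) :=
  ⟨handOff_image_cone_subset (by linarith), ⟨inputBoxCone hc₀⟩⟩

/-- **The certified per-generation energy fraction**: output energy `≥ zL²·E_level`, input energy
`≤ (1 + 3·10⁻⁵)·E_level`, so at least `EoutL/(1 + 3·10⁻⁵) ≥ 0.9223` of a generation's energy is
handed down (and at most all of it plus the forcing's `6·10⁻⁵`). [folklore] -/
theorem eta_cert_ge : (0.9223 : ℝ) ≤ EoutL / (1 + 3 / 10 ^ 5) := by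
  rw [le_div_iff₀ (by norm_num)]
  norm_num [EoutL]

/-- **IN THE SPEC WINDOW.** A cascade whose per-generation fraction `η` is at least the certified
`EoutL/(1 + 3·10⁻⁵)` has `α_eff ≥ 2` (the dimensional closure outruns viscosity,
`CascadeSpecs.two_le_alphaEff_iff : 2 ≤ α_eff ↔ 1/2 ≤ η`) and `η > 1/4` (detectability).
This is arithmetic on the blueprint's dictionary, not a statement about a fluid. [folklore] -/
theorem alphaEff_ge_two_of_eta (S : CascadeSpecs) (hη : EoutL / (1 + 3 / 10 ^ 5) ≤ S.eta) :
    2 ≤ S.alphaEff ∧ 1 / 4 < S.eta := by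
  have h := eta_cert_ge
  exact ⟨S.two_le_alphaEff_iff.2 (by linarith), by linarith⟩

/-! ### §4. THE HAND-OFF AUDIT — what `handOff` idealises (honest ledger)

`handOff zL` is a RE-INITIALISATION, not a map the coupled dynamics performs. At the hand-off instant it
erases: (E1) the four fresh modes of generation `n+1` (set to `0`, i.e. inside the input box tolerances
`|b| ≤ 10⁻⁵`, `0 ≤ c ≤ 10⁻⁷`, `2d² + ã² ≤ 7.5·10⁻¹¹`, times the level); (E2) the leftover of generation
`n` (up to `1 - EoutL/(1+3·10⁻⁵) ≤ 7.8 %` of its energy, `handOff_discards_le`), which in the coupled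
system keeps feeding the new carrier through the pump `κ d² ≥ 0`; (E3) the RAMP: the new carrier is
loaded over the transfer width of generation `n` (`0.103` of its time unit at A = 2, `0.033` at A = 5,
`0.018` at A = 8), i.e. over `≈ width·Λ` of generation `n+1`'s faster unit (`Λ` = coefficient speed-up
per generation; `2^{5/2} ≈ 5.66` under the dimensional closure), not as a step.

MEASURED (bp3 gen 14, `code/thgate/g14/chain.py`, data `data/thgate/chain-g14/`; two threshold gates in
series as ONE energy-conserving 9-mode ODE — the output mode of gate 1 IS the carrier of gate 2 — versus
gate 2 restarted from the step input `(√E_in, 0, 0, 0, 0)`; design ladder A ∈ {2, 3, 5, 8, 12} at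
od = 20 (A = 2 is `Gt`), Λ ∈ {1, 2, 4, 5.66, 8}, unforced, RK4 with energy drift ≤ 5·10⁻⁹):
(M1) gate 2's efficiency equals the step-input gate's to six digits (e.g. `0.940021` at A = 2,
`0.956798` at A = 8) and the chain hands down exactly `η₁η₂` of the original energy (`0.8836` at A = 2,
`0.9155` at A = 8); its transfer width equals the step-input width to ≤ 0.5 %;
(M2) gate 2 releases only after `≥ 99.6 %` of its eventual input has arrived; its delay measured from
80 %-arrival is SHORTER than the step-input delay by 0.3–1.7 % at Λ = 1 and by 1.5 % (A = 8), 2.9 %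
(A = 5), 9.5 % (A = 2) at Λ = 5.66 — the clock integrates `ε a²` during the ramp, by an amount that
shrinks with the ramp width;
(M3) at gate 1's REACH EVENT (downstream energy first `≥ EoutL`, the earliest instant at which the
certificate layer could hand off) gate 2's fresh modes are NOT in the scaled input box: clock
`b₂ = 0.5–3 %` of its threshold at Λ = 1 and `2–15 %` at Λ = 5.66 (`67×`–`3060×` the box tolerance),
trigger `c₂` at `0.84–1.14` of its quasi-equilibrium `σa/μ` (`1.3×`–`43×` the box), conduit
`d₂ = 15×`–`480×` the box.
READING: the input box is a typing artefact of the single-gate certificate — the coupled chain works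
with no measurable loss although no instant of it lies in that box; the missing formal object is a
certificate for generation `n+1` started from the RAMP (a 6-mode stage whose input is the upstream
conduit `d_n`, clock pre-advanced in proportion to the energy-time received), not a new mechanism.
None of (E1)–(E3) is certified in this file; the numbers are double-precision ODE runs, not interval
arithmetic, and say nothing about a fluid. -/

/-- **What the hand-off erases, formally**: the handed-off state has empty clock, trigger, conduit
and output, and carrier `z 4 / zL`, whatever the other four coordinates of the actual end state `z`
were. [cite: Tao2016AveragedNS, §6.1 (6.1), (6.4)] -/
theorem handOff_fresh_modes (z : Fin 5 → ℝ) :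
    handOff zL z 0 = z 4 / zL ∧ handOff zL z 1 = 0 ∧ handOff zL z 2 = 0 ∧ handOff zL z 3 = 0 ∧
      handOff zL z 4 = 0 := by
  simp [handOff, delayInit]

/-- **… while the actual end-of-cycle state is only known to the energy tube**: at the reach time
the certificate locates the state in `{ã ≥ c·zL} ∩ energyTube`, i.e. the other four modes carry at
most `E(p)(1 + 6·10⁻⁵) - (c zL)²` of energy — up to `7.8 %` of the level energy, not `0`. The
idealised hand-off discards exactly this remainder. [folklore] -/
theorem handOff_discards_le {c : ℝ} {X : Fin 5 → ℝ} (hX : X ∈ outputAbove (c * zL)) (hc : 0 ≤ c) :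
    X 0 ^ 2 + X 1 ^ 2 + X 2 ^ 2 + X 3 ^ 2 ≤ energy X - (c * zL) ^ 2 := by
  rw [mem_outputAbove] at hX
  have h4 : (c * zL) ^ 2 ≤ X 4 ^ 2 := pow_le_pow_left₀ (mul_nonneg hc zL_pos.le) hX 2
  rw [Ignition.energy_five]
  linarith

end TubeStage

end Summit.NavierStokesRegularity.FluidComputer

end
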